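import Summits.BirchSwinnertonDyer.BirchSwinnertonDyer.Theorems.KolyvaginRankRigidityAtTwoRegularRefillLaw
import Summits.BirchSwinnertonDyer.BirchSwinnertonDyer.Theorems.KolyvaginRankRigidityAtTwoSwapPairingUpperBoundFamilyAtTwo
import Summits.BirchSwinnertonDyer.BirchSwinnertonDyer.Theorems.AdditiveKolyvaginRoadLagrangianSwitchAtPLines
import Summits.BirchSwinnertonDyer.Rank1Residual.X11b.KummerPoitouTateExact
import HarnessLib

/-!
# Crux U1 `KolyvaginBoundedDefectAtTwo` (stmt-BirchSwinnertonDyer-28083), LINE 17 `regular_core_rigidity` v3,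
# stub S1b `stub_nearCoreExistenceAtTwo` — the REFILL LAW IN SITU: at a Kolyvagin place `v ∣ ℓ` of index `≥ M + 1`
# the pair (Kummer, ring-class transverse) in `H¹(K_v, E[2^M])` under `inv_v(· ∪ₑ ·)` is a complementary
# Lagrangian pair, so every Lagrangian `X ≤ H¹(K_v, E[2^M])` with a co-cyclic Kummer cut obeys `2·ann_𝒯(A) ⊆ X`

Width seat `bsd-line-krr2-p2` g13 (ONE READER on S1b, re-key (280)(c)); `--supports stmt-BirchSwinnertonDyer-28083`
(helper). THEOREMS ONLY: nothing here proves S1b, U1, a rung or BSD. BSD is NOT proved.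

## What

The abstract refill law (`RegularRefill.two_nsmul_mem_of_lagrangian_of_cyclic`, p671760; graph lemma p671017) has
seven LOCAL hypotheses on `(L, b, H_f, H_tr)` and two on the Lagrangian `X`. This file discharges the seven local ones
for `L = H¹(K_v, E[2^M])`, `b = inv_v(· ∪ₑ ·)` (`X11b.Relaxation.invWeilPairing`), `H_f = Kum_v` (the Kummer
condition) and `H_tr = 𝒯_v` (the ring-class transverse condition of a square-free Kolyvagin conductor `c`, every prime
of index `≥ M + 1`) at a place `v` of `c`, on the habitat `K` imaginary quadratic, `d_K < −4`, from TREE THEOREMS ONLY: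
* `b` is SYMMETRIC (`AdditiveKoly.LagrangianSwitchAtP.invWeilPairing_symm`: graded commutativity for the skew Weil
  pairing) and non-degenerate (`X11b.KummerPT.invWeilPairing_flip_bijective`, local Tate duality) —
  `invWeilPairing_injective_of_symm`;
* `Kum_v ⊓ 𝒯_v = ⊥` and `Kum_v ⊔ 𝒯_v = ⊤` — `kummer_inf_transverse_eq_bot_two` / `kummer_sup_transverse_eq_top_two`
  (disjointness `JET.Walk.disjoint_kummer_iInf_transverseSubgroup`; the counts `#𝒯_v = #E(K_v)[2^M] = #Kum_v`,
  `#H¹(K_v, E[2^M]) = #E(K_v)[2^M]²` — this lineage's g7 file `…SwapPairingUpperBoundFamilyAtTwo`, re-run);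
* `Kum_v` isotropic (Poonen–Rains, `X11b.Relaxation.invWeilPairing_eq_zero_of_mem`) and `𝒯_v` isotropic (the LEAD's
  Lagrangian theorem at `2` with margin one, `dualTransported_eq_of_localTransverseFamily_two`, read through
  `X5.SelfDualCount.dualTransported_weilDual_eq_annRight`) — `transverse_isotropic_two`.
Hence, for ANY subgroup `X ≤ H¹(K_v, E[2^M])` that is isotropic with `#X = #Kum_v` (in the walk: the image at `v`
of the Selmer group of `𝓕(n)` relaxed at `v`, `c = nℓ`; both properties are Poitou–Tate for `𝓕_v(n) ≤ 𝓕^v(n)`) and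
whose Kummer cut is co-cyclic (`Kum_v = (X ∩ Kum_v) + ℤe₀`, e.g. the pure-sign cut at a REGULAR prime):
* `two_nsmul_mem_of_lagrangian_kolyvaginPlace_two` — `2t ∈ X` for every `t ∈ 𝒯_v` annihilating `X ∩ Kum_v`;
* `natCard_kummer_le_two_mul_kolyvaginPlace_two` — `#Kum_v ≤ 2 · #(X ∩ Kum_v) · #(X ∩ 𝒯_v)` (refill exponent
  `a ≥ M − 1` at a pure-sign step);
and the first GLOBAL input in situ:
* `invWeilPairing_localization_eq_zero_of_hybrid_off` — the image at `v` of global classes satisfying the hybrid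
  conditions OFF `v` (transverse at the other places of `c`, Kummer at every other place) is ISOTROPIC
  (Poitou–Tate reciprocity `sum_inv_weilCupProduct_localization_eq_zero` + the two isotropies place by place).
NOT here: the count `#X = #Kum_v` for that image (Poitou–Tate counting for the hybrid structure strict/relaxed at `v`;
the `c = 1` case is `X5.SelfDualCount.relIndex_kummerStrict_kummerRelaxed_singleton_eq`), the walk, the engine.
References (locators only; no cited FACT is declared): [cite: MazurRubin2004, Lemma 1.2.4, Prop. 1.3.2 (ii)]
[cite: Howard2004HeegnerKolyvagin, Prop. 2.1.9, Thm. 2.1.11] [cite: MilneADT2006, Ch. I, Cor. 2.3, Thm. 4.10 (b)]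
[cite: PoonenRains2012, Prop. 4.10–4.11] [cite: NeukirchSchmidtWingberg2008, I §4 Prop. 1.4.4].
Design: no definitions; `K : Type`; axioms `propext`, `Classical.choice`, `Quot.sound`.
-/

set_option autoImplicit false
-- the Theorems namespace of this sub repeats the summit name by design (D-0017 nested layout)
set_option linter.dupNamespace false

noncomputable section

open scoped Classical
open Function NumberField IsDedekindDomain WeierstrassCurve Field
open Literature.NumberTheory.EllipticCurves Literature.NumberTheory.EllipticCurves.Jetchev2008
open Literature.NumberTheory.GaloisRepresentations Literature.NumberTheory.GaloisCohomology
open Literature.NumberTheory.GaloisRepresentations.DiscreteGaloisModule (localTatePairingZMod tateDual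
  transverseSubgroup SelmerStructure)
open Literature.NumberTheory.Automorphic
open Summit.BirchSwinnertonDyer.Rank1Residual
open Summit.BirchSwinnertonDyer.Rank1Residual.JET.RingClassTransverse
open Summit.BirchSwinnertonDyer.Rank1Residual.JET.SelmerVocabulary
open Summit.BirchSwinnertonDyer.Rank1Residual.X11b.Relaxation (invWeilPairing invWeilPairing_apply
  invWeilPairing_eq_zero_of_mem)
open Summit.BirchSwinnertonDyer.Rank1Residual.X11b.FiniteDuality (annRight mem_annRight_iff)
open Summit.BirchSwinnertonDyer.BirchSwinnertonDyer.Theorems.KolyvaginLowerBoundAtTwo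

namespace Summit.BirchSwinnertonDyer.BirchSwinnertonDyer.Theorems.KolyvaginAtTwo.RegularRefill

-- cup products need the compactness of the local absolute Galois groups (as in the tree's cup-product files)
attribute [local instance] absoluteGaloisGroup_compactSpace

variable {K : Type} [Field K] [NumberField K] (W : WeierstrassCurve ℚ) [W.IsElliptic] [W.IsGloballyMinimal]
  (M : ℕ)
  (e : geomTorsion (W.baseChange K) ((2 ^ M : ℕ) : ℤ) → geomTorsion (W.baseChange K) ((2 ^ M : ℕ) : ℤ) →
    AlgebraicClosure K)
  (hμ : ∀ S T, e S T ^ (2 ^ M) = 1)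
  (hadd₁ : ∀ S₁ S₂ T, e (S₁ + S₂) T = e S₁ T * e S₂ T)
  (hadd₂ : ∀ S T₁ T₂, e S (T₁ + T₂) = e S T₁ * e S T₂)
  (hgal : ∀ (g : absoluteGaloisGroup K) (S T : geomTorsion (W.baseChange K) ((2 ^ M : ℕ) : ℤ)),
    g • e S T = e (g • S) (g • T))
  (halt : ∀ T, e T T = 1) (hnondeg : ∀ T, (∀ S, e S T = 1) → T = 0)
  (inv : LocalInvariants K (2 ^ M))

/-! ### §1 The local pairing `inv_v(· ∪ₑ ·)`: symmetric and non-degenerate -/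

omit [W.IsGloballyMinimal] in
include halt hnondeg in
/-- **`inv_v(· ∪ₑ ·)` is injective (as a map to the dual)** at a finite place with `inv_v` injective: its flip is
bijective (local Tate duality, `X11b.KummerPT.invWeilPairing_flip_bijective`) and it is symmetric
(`AdditiveKoly.LagrangianSwitchAtP.invWeilPairing_symm`). [cite: MilneADT2006, Ch. I, Cor. 2.3] -/
theorem invWeilPairing_injective_of_symm [NeZero (2 ^ M)] (v : HeightOneSpectrum (𝓞 K))
    (hinv : Injective (inv (Sum.inr v))) :
    Injective (invWeilPairing (W.baseChange K) (2 ^ M) e hμ hadd₁ hadd₂ hgal inv (Sum.inr v)) := by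
  have hflip := (X11b.KummerPT.invWeilPairing_flip_bijective (W.baseChange K) (2 ^ M) e hμ hadd₁ hadd₂ hgal
    hnondeg inv v hinv).1
  have heq : (invWeilPairing (W.baseChange K) (2 ^ M) e hμ hadd₁ hadd₂ hgal inv (Sum.inr v)).flip =
      invWeilPairing (W.baseChange K) (2 ^ M) e hμ hadd₁ hadd₂ hgal inv (Sum.inr v) := by
    ext x y
    rw [AddMonoidHom.flip_apply]
    exact AdditiveKoly.LagrangianSwitchAtP.invWeilPairing_symm (W.baseChange K) (2 ^ M) e hμ hadd₁ hadd₂ hgal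
      halt inv (Sum.inr v) y x
  rwa [heq] at hflip

/-! ### §2 The pair (Kummer, ring-class transverse) at a place of the conductor: complementary and Lagrangian -/

section Conductor

variable (hK : IsImaginaryQuadratic K) (hD : NumberField.discr K < -4) (ι : K →+* ℂ)
  [∀ j : ℕ, NumberField (ringClassField K ι j)] (hM : 1 ≤ M)
  (c : ℕ) (hc : Squarefree c)
  (hkol : ∀ ℓ ∈ c.primeFactors, Zhang2014.IsKolyvaginPrime (W.conductorNorm ℤ) W K 2 ℓ)
  (hkM : ∀ ℓ ∈ c.primeFactors, M + 1 ≤ Zhang2014.kolyvaginIndex W 2 ℓ)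
  (𝒯 : SelmerStructure ((W.baseChange K).torsionGaloisModule ((2 ^ M : ℕ) : ℤ)))
  (h𝒯 : ∀ v : HeightOneSpectrum (𝓞 K), 𝒯 (Sum.inr v) =
    ⨅ ℓ ∈ c.primeFactors.filter (fun ℓ : ℕ ↦ ((ℓ : ℕ) : 𝓞 K) ∈ v.asIdeal),
      ⨅ (w' : HeightOneSpectrum (𝓞 (ringClassField K ι ℓ))) (_ : w'.asIdeal.LiesOver v.asIdeal),
        letI := (adicCompletionOfLiesOver K (ringClassField K ι ℓ) v w').toAlgebra
        transverseSubgroup (GaloisRep.toLocal v ((W.baseChange K).torsionGaloisModule ((2 ^ M : ℕ) : ℤ)))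
          (w'.adicCompletion (ringClassField K ι ℓ)))
  (hperf : inv.IsPerfect)
  (v : HeightOneSpectrum (𝓞 K)) (hvc : v ∈ placesDividing K c)

include hK hD hM hc hkol hkM h𝒯 hvc in
/-- **`Kum_v ⊓ 𝒯_v = ⊥` and `#H¹(K_v, E[2^M]) ≤ #Kum_v · #𝒯_v`** at a place `v` of the square-free Kolyvagin conductor
`c` (indices `≥ M + 1`): disjointness by `JET.Walk.disjoint_kummer_iInf_transverseSubgroup`, the count by
`#𝒯_v = #E(K_v)[2^M] = #Kum_v` and `#H¹ = #E(K_v)[2^M]²` (this lineage's g7 computation, re-run).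
[cite: MazurRubin2004, Lemma 1.2.4] [cite: MilneADT2006, Ch. I, Lemma 2.9, Thm. 2.8] -/
theorem kummer_disjoint_transverse_and_card_le_two [NeZero (2 ^ M)] :
    Disjoint ((W.baseChange K).kummerSelmerStructure ((2 ^ M : ℕ) : ℤ) (Sum.inr v : Place K)) (𝒯 (Sum.inr v)) ∧
    Nat.card (galoisCohomology ((((W.baseChange K).torsionGaloisModule ((2 ^ M : ℕ) : ℤ))).toLocal
        (Sum.inr v : Place K)) 1) ≤
      Nat.card ((W.baseChange K).kummerSelmerStructure ((2 ^ M : ℕ) : ℤ) (Sum.inr v : Place K)) *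
        Nat.card (𝒯 (Sum.inr v)) := by
  classical
  haveI : Fact (Nat.Prime 2) := ⟨Nat.prime_two⟩
  haveI : CharZero (v.adicCompletion K) := charZero_adicCompletion v
  have hc0 : c ≠ 0 := hc.ne_zero
  obtain ⟨ℓ₀, hℓ₀c, hℓ₀v⟩ := (natCast_mem_iff_exists_primeFactor_mem hc0 v).mp
    ((mem_placesDividing_iff_natCast_mem hc0 v).mp hvc)
  have hℓ₀ := hkol ℓ₀ hℓ₀c
  have hℓ₀p : ℓ₀.Prime := hℓ₀.1
  have hℓ₀0 : ℓ₀ ≠ 0 := hℓ₀p.ne_zero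
  have hMℓ₀ : M ≤ Zhang2014.kolyvaginIndex W 2 ℓ₀ := Nat.le_of_succ_le (hkM ℓ₀ hℓ₀c)
  have huniq : ∀ ℓ ∈ c.primeFactors, ((ℓ : ℕ) : 𝓞 K) ∈ v.asIdeal → ℓ = ℓ₀ := by
    intro ℓ hℓc hℓv
    by_contra hne
    have hcop : Nat.Coprime ℓ₀ ℓ :=
      (Nat.coprime_primes hℓ₀p (Nat.prime_of_mem_primeFactors hℓc)).mpr (Ne.symm hne)
    exact X11b.Three.Koly.Method2.not_mem_asIdeal_of_coprime K hcop v hℓ₀v hℓv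
  haveI := (finiteDimensional_and_isGalois_ringClassField hK ι hℓ₀0).2
  obtain ⟨w₀⟩ := (inferInstance : Nonempty (SemiLocal.Place K (ringClassField K ι ℓ₀) v))
  haveI hw₀ : (w₀ : HeightOneSpectrum (𝓞 (ringClassField K ι ℓ₀))).asIdeal.LiesOver v.asIdeal :=
    SemiLocal.Place.liesOver w₀
  letI := (adicCompletionOfLiesOver K (ringClassField K ι ℓ₀) v
    (w₀ : HeightOneSpectrum (𝓞 (ringClassField K ι ℓ₀)))).toAlgebra
  have h𝒯v : 𝒯 (Sum.inr v) =
      transverseSubgroup (GaloisRep.toLocal v ((W.baseChange K).torsionGaloisModule ((2 ^ M : ℕ) : ℤ)))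
        ((w₀ : HeightOneSpectrum (𝓞 (ringClassField K ι ℓ₀))).adicCompletion (ringClassField K ι ℓ₀)) := by
    rw [h𝒯 v]
    ext y
    simp only [AddSubgroup.mem_iInf, Finset.mem_filter, and_imp]
    constructor
    · intro H
      exact H ℓ₀ hℓ₀c hℓ₀v (w₀ : HeightOneSpectrum (𝓞 (ringClassField K ι ℓ₀))) hw₀
    · intro hy ℓ hℓc hℓv w' hw'
      obtain rfl := huniq ℓ hℓc hℓv
      rw [transverseSubgroup_adicCompletion_eq_of_liesOver
        ((W.baseChange K).torsionGaloisModule ((2 ^ M : ℕ) : ℤ)) (ringClassField K ι ℓ) v w'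
        (w₀ : HeightOneSpectrum (𝓞 (ringClassField K ι ℓ)))]
      exact hy
  refine ⟨?_, ?_⟩
  · have h := JET.Walk.disjoint_kummer_iInf_transverseSubgroup W K hK hD ι M hℓ₀ v hℓ₀v
    refine h.mono_right ?_
    rw [h𝒯 v]
    exact iInf₂_le ℓ₀ (Finset.mem_filter.mpr ⟨hℓ₀c, hℓ₀v⟩)
  · have hpv : ((2 : ℕ) : 𝓞 K) ∉ v.asIdeal := by
      have h := (hasGoodReductionAt_of_zhangKolyvagin W K Nat.prime_two hℓ₀ v hℓ₀v 1).2
      rwa [pow_one, Int.cast_natCast] at h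
    have hgood := (hasGoodReductionAt_of_zhangKolyvagin W K Nat.prime_two hℓ₀ v hℓ₀v 1).1
    have hTc : Nat.card (𝒯 (Sum.inr v)) = Nat.card (nsmulAddMonoidHom (2 ^ M) :
        ((W.baseChange K).baseChange (v.adicCompletion K)).toAffine.Point →+ _).ker := by
      rw [h𝒯v]
      exact natCard_transverseSubgroup_ringClassField_eq W K hK hD ι M hℓ₀ hMℓ₀ v hℓ₀v
        (w₀ : HeightOneSpectrum (𝓞 (ringClassField K ι ℓ₀)))
    have hKc : Nat.card ((W.baseChange K).kummerSelmerStructure ((2 ^ M : ℕ) : ℤ) (Sum.inr v : Place K)) =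
        Nat.card (nsmulAddMonoidHom (2 ^ M) :
          ((W.baseChange K).baseChange (v.adicCompletion K)).toAffine.Point →+ _).ker := by
      rw [X11b.KummerPT.kummerSelmerStructure_inr_eq_unramifiedSubgroup (W.baseChange K) 2 M hpv hgood]
      exact GaloisImage.LocalH1UnramifiedSquare.natCard_unramifiedSubgroup_torsion_adicCompletion_eq_of_ne_zero
        (W.baseChange K) v (NeZero.ne (2 ^ M))
    have hH1 : Nat.card (galoisCohomology ((((W.baseChange K).torsionGaloisModule ((2 ^ M : ℕ) : ℤ))).toLocal
          (Sum.inr v : Place K)) 1) =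
        Nat.card (nsmulAddMonoidHom (2 ^ M) :
          ((W.baseChange K).baseChange (v.adicCompletion K)).toAffine.Point →+ _).ker ^ 2 := by
      have h := GaloisImage.natCard_galoisCohomology_one_torsion_adicCompletion_eq_sq_of_not_mem (W.baseChange K)
        v 2 hpv (M - 1)
      rw [Nat.sub_add_cancel hM] at h
      exact h
    rw [hH1, hKc, hTc, sq]

include hK hD hM hc hkol hkM h𝒯 hvc in
/-- **`Kum_v ⊓ 𝒯_v = ⊥`.** [cite: MazurRubin2004, Lemma 1.2.4] -/
theorem kummer_inf_transverse_eq_bot_two [NeZero (2 ^ M)] :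
    ((W.baseChange K).kummerSelmerStructure ((2 ^ M : ℕ) : ℤ) (Sum.inr v : Place K)) ⊓ 𝒯 (Sum.inr v) = ⊥ :=
  (kummer_disjoint_transverse_and_card_le_two W M hK hD ι hM c hc hkol hkM 𝒯 h𝒯 v hvc).1.eq_bot

include hK hD hM hc hkol hkM h𝒯 hvc in
/-- **`Kum_v ⊔ 𝒯_v = ⊤`: `H¹(K_v, E[2^M]) = Kum_v ⊕ 𝒯_v`** (disjoint of complementary size).
[cite: MazurRubin2004, Lemma 1.2.4] -/
theorem kummer_sup_transverse_eq_top_two [NeZero (2 ^ M)] [Finite (geomTorsion (W.baseChange K) ((2 ^ M : ℕ) : ℤ))] :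
    ((W.baseChange K).kummerSelmerStructure ((2 ^ M : ℕ) : ℤ) (Sum.inr v : Place K)) ⊔ 𝒯 (Sum.inr v) = ⊤ := by
  haveI : Finite (galoisCohomology ((((W.baseChange K).torsionGaloisModule ((2 ^ M : ℕ) : ℤ))).toLocal
      (Sum.inr v : Place K)) 1) := finite_galoisCohomology_one_toLocal _ v
  obtain ⟨hdisj, hcard⟩ := kummer_disjoint_transverse_and_card_le_two W M hK hD ι hM c hc hkol hkM 𝒯 h𝒯 v hvc
  have h := LagrangianSign.card_sup_mul_card_inf
    ((W.baseChange K).kummerSelmerStructure ((2 ^ M : ℕ) : ℤ) (Sum.inr v : Place K)) (𝒯 (Sum.inr v))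
  rw [hdisj.eq_bot, AddSubgroup.card_bot, mul_one] at h
  apply AddSubgroup.eq_top_of_card_eq
  refine le_antisymm (Nat.card_le_card_of_injective _ Subtype.val_injective) ?_
  rw [h]; exact hcard

include hK hD hM hc hkol hkM h𝒯 halt hnondeg hperf hvc in
/-- **`𝒯_v` is isotropic for `inv_v(· ∪ₑ ·)`** (index `≥ M + 1`: the LEAD's Lagrangian theorem at `2`, margin one,
`dualTransported_eq_of_localTransverseFamily_two`, read as `𝒯_v = 𝒯_v^⊥` through
`X5.SelfDualCount.dualTransported_weilDual_eq_annRight`). [cite: Howard2004HeegnerKolyvagin, Prop. 2.1.9 (ii)]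
[cite: MazurRubin2004, Prop. 1.3.2 (ii)] -/
theorem transverse_isotropic_two [NeZero (2 ^ M)] [Finite (geomTorsion (W.baseChange K) ((2 ^ M : ℕ) : ℤ))]
    {x y : galoisCohomology ((((W.baseChange K).torsionGaloisModule ((2 ^ M : ℕ) : ℤ))).toLocal
      (Sum.inr v : Place K)) 1}
    (hx : x ∈ 𝒯 (Sum.inr v)) (hy : y ∈ 𝒯 (Sum.inr v)) :
    invWeilPairing (W.baseChange K) (2 ^ M) e hμ hadd₁ hadd₂ hgal inv (Sum.inr v) x y = 0 := by
  have h𝒯sd := dualTransported_eq_of_localTransverseFamily_two W K hK hD ι M hM c hc hkol hkM 𝒯 h𝒯 e hμ hadd₁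
    hadd₂ hgal halt hnondeg inv hperf v hvc
  rw [X5.SelfDualCount.dualTransported_weilDual_eq_annRight (W.baseChange K) (2 ^ M) e hμ hadd₁ hadd₂ hgal inv 𝒯
    (Sum.inr v)] at h𝒯sd
  have hy' : y ∈ annRight (invWeilPairing (W.baseChange K) (2 ^ M) e hμ hadd₁ hadd₂ hgal inv (Sum.inr v))
      (𝒯 (Sum.inr v)) := by rw [h𝒯sd]; exact hy
  exact (mem_annRight_iff _ _ y).mp hy' x hx

/-! ### §3 The refill law and its counting form at a place of the conductor -/

include hK hD hM hc hkol hkM h𝒯 halt hnondeg hperf hvc in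
/-- **REFILL LAW IN SITU.** At a place `v` of the square-free Kolyvagin conductor `c` (indices `≥ M + 1`), let
`X ≤ H¹(K_v, E[2^M])` be isotropic for `inv_v(· ∪ₑ ·)` with `#X = #Kum_v` (a Lagrangian — in the walk: the image at `v`
of `H_{𝓕^v(n)}`, `c = nℓ`), whose Kummer cut is co-cyclic: `Kum_v = (X ∩ Kum_v) + ℤe₀` (at a REGULAR `ℓ` with a
pure-sign cut `(1+h)Kum_v`). Then `2t ∈ X` for every `t ∈ 𝒯_v` annihilating `X ∩ Kum_v` — the refill
`X ∩ 𝒯_v = loc_v(H_{𝓕(nℓ)})` contains `2 · ann_{𝒯_v}(X ∩ Kum_v)`. The abstract law (`two_nsmul_mem_of_lagrangian_of_cyclic`)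
with §1–§2. [cite: MazurRubin2004, Prop. 1.3.2, §4.1] [cite: Howard2004HeegnerKolyvagin, Thm. 2.1.11] -/
theorem two_nsmul_mem_of_lagrangian_kolyvaginPlace_two [NeZero (2 ^ M)]
    [Finite (geomTorsion (W.baseChange K) ((2 ^ M : ℕ) : ℤ))]
    (X : AddSubgroup (galoisCohomology ((((W.baseChange K).torsionGaloisModule ((2 ^ M : ℕ) : ℤ))).toLocal
      (Sum.inr v : Place K)) 1))
    (hX : ∀ x ∈ X, ∀ y ∈ X, invWeilPairing (W.baseChange K) (2 ^ M) e hμ hadd₁ hadd₂ hgal inv (Sum.inr v) x y = 0)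
    (hcard : Nat.card X = Nat.card ((W.baseChange K).kummerSelmerStructure ((2 ^ M : ℕ) : ℤ) (Sum.inr v : Place K)))
    {e₀ : galoisCohomology ((((W.baseChange K).torsionGaloisModule ((2 ^ M : ℕ) : ℤ))).toLocal (Sum.inr v : Place K)) 1}
    (he₀ : e₀ ∈ (W.baseChange K).kummerSelmerStructure ((2 ^ M : ℕ) : ℤ) (Sum.inr v : Place K))
    (hcyc : ∀ f ∈ (W.baseChange K).kummerSelmerStructure ((2 ^ M : ℕ) : ℤ) (Sum.inr v : Place K),
      ∃ k : ℤ, f - k • e₀ ∈ X)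
    {t : galoisCohomology ((((W.baseChange K).torsionGaloisModule ((2 ^ M : ℕ) : ℤ))).toLocal (Sum.inr v : Place K)) 1}
    (ht : t ∈ 𝒯 (Sum.inr v))
    (hann : ∀ a ∈ X ⊓ (W.baseChange K).kummerSelmerStructure ((2 ^ M : ℕ) : ℤ) (Sum.inr v : Place K),
      invWeilPairing (W.baseChange K) (2 ^ M) e hμ hadd₁ hadd₂ hgal inv (Sum.inr v) a t = 0) :
    2 • t ∈ X := by
  haveI : Finite (galoisCohomology ((((W.baseChange K).torsionGaloisModule ((2 ^ M : ℕ) : ℤ))).toLocal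
      (Sum.inr v : Place K)) 1) := finite_galoisCohomology_one_toLocal _ v
  have hinv : Injective (inv (Sum.inr v)) := (hperf v).1.1
  refine two_nsmul_mem_of_lagrangian_of_cyclic
    (invWeilPairing (W.baseChange K) (2 ^ M) e hμ hadd₁ hadd₂ hgal inv (Sum.inr v))
    (X11b.KummerPT.nsmul_galoisCohomology_toLocal_eq_zero (W.baseChange K) (2 ^ M) (Sum.inr v))
    (fun x y ↦ AdditiveKoly.LagrangianSwitchAtP.invWeilPairing_symm (W.baseChange K) (2 ^ M) e hμ hadd₁ hadd₂ hgal
      halt inv (Sum.inr v) x y)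
    (kummer_inf_transverse_eq_bot_two W M hK hD ι hM c hc hkol hkM 𝒯 h𝒯 v hvc)
    (kummer_sup_transverse_eq_top_two W M hK hD ι hM c hc hkol hkM 𝒯 h𝒯 v hvc)
    (fun x hx y hy ↦ invWeilPairing_eq_zero_of_mem (W.baseChange K) (2 ^ M) e hμ hadd₁ hadd₂ hgal halt inv
      (Sum.inr v) hx hy)
    (fun x hx y hy ↦ transverse_isotropic_two W M e hμ hadd₁ hadd₂ hgal halt hnondeg inv hK hD ι hM c hc hkol hkM 𝒯
      h𝒯 hperf v hvc hx hy)
    (invWeilPairing_injective_of_symm W M e hμ hadd₁ hadd₂ hgal halt hnondeg inv v hinv) X hX hcard he₀ hcyc ?_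
  rw [mem_inf_iInf_ker_iff]
  exact ⟨ht, hann⟩

include hK hD hM hc hkol hkM h𝒯 halt hnondeg hperf hvc in
/-- **REFILL LAW IN SITU, COUNTING FORM: `#Kum_v ≤ 2 · #(X ∩ Kum_v) · #(X ∩ 𝒯_v)`** under the hypotheses of
`two_nsmul_mem_of_lagrangian_kolyvaginPlace_two` — with `#Kum_v = #E(K_v)[2^M] = 2^(2M)` and a pure-sign cut
`#(X ∩ Kum_v) = 2^M` at a regular prime: the refill `X ∩ 𝒯_v` has order `≥ 2^(M−1)`, refill exponent `a ≥ M − 1`.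
[cite: MazurRubin2004, Prop. 1.3.2, §4.1] [cite: Howard2004HeegnerKolyvagin, Thm. 2.1.11] -/
theorem natCard_kummer_le_two_mul_kolyvaginPlace_two [NeZero (2 ^ M)]
    [Finite (geomTorsion (W.baseChange K) ((2 ^ M : ℕ) : ℤ))]
    (X : AddSubgroup (galoisCohomology ((((W.baseChange K).torsionGaloisModule ((2 ^ M : ℕ) : ℤ))).toLocal
      (Sum.inr v : Place K)) 1))
    (hX : ∀ x ∈ X, ∀ y ∈ X, invWeilPairing (W.baseChange K) (2 ^ M) e hμ hadd₁ hadd₂ hgal inv (Sum.inr v) x y = 0)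
    (hcard : Nat.card X = Nat.card ((W.baseChange K).kummerSelmerStructure ((2 ^ M : ℕ) : ℤ) (Sum.inr v : Place K)))
    {e₀ : galoisCohomology ((((W.baseChange K).torsionGaloisModule ((2 ^ M : ℕ) : ℤ))).toLocal (Sum.inr v : Place K)) 1}
    (he₀ : e₀ ∈ (W.baseChange K).kummerSelmerStructure ((2 ^ M : ℕ) : ℤ) (Sum.inr v : Place K))
    (hcyc : ∀ f ∈ (W.baseChange K).kummerSelmerStructure ((2 ^ M : ℕ) : ℤ) (Sum.inr v : Place K),
      ∃ k : ℤ, f - k • e₀ ∈ X) :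
    Nat.card ((W.baseChange K).kummerSelmerStructure ((2 ^ M : ℕ) : ℤ) (Sum.inr v : Place K)) ≤
      2 * Nat.card ↥(X ⊓ (W.baseChange K).kummerSelmerStructure ((2 ^ M : ℕ) : ℤ) (Sum.inr v : Place K)) *
        Nat.card ↥(X ⊓ 𝒯 (Sum.inr v)) := by
  haveI : Finite (galoisCohomology ((((W.baseChange K).torsionGaloisModule ((2 ^ M : ℕ) : ℤ))).toLocal
      (Sum.inr v : Place K)) 1) := finite_galoisCohomology_one_toLocal _ v
  have hinv : Injective (inv (Sum.inr v)) := (hperf v).1.1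
  exact natCard_le_two_mul_of_lagrangian_of_cyclic
    (invWeilPairing (W.baseChange K) (2 ^ M) e hμ hadd₁ hadd₂ hgal inv (Sum.inr v))
    (X11b.KummerPT.nsmul_galoisCohomology_toLocal_eq_zero (W.baseChange K) (2 ^ M) (Sum.inr v))
    (fun x y ↦ AdditiveKoly.LagrangianSwitchAtP.invWeilPairing_symm (W.baseChange K) (2 ^ M) e hμ hadd₁ hadd₂ hgal
      halt inv (Sum.inr v) x y)
    (kummer_inf_transverse_eq_bot_two W M hK hD ι hM c hc hkol hkM 𝒯 h𝒯 v hvc)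
    (kummer_sup_transverse_eq_top_two W M hK hD ι hM c hc hkol hkM 𝒯 h𝒯 v hvc)
    (fun x hx y hy ↦ invWeilPairing_eq_zero_of_mem (W.baseChange K) (2 ^ M) e hμ hadd₁ hadd₂ hgal halt inv
      (Sum.inr v) hx hy)
    (fun x hx y hy ↦ transverse_isotropic_two W M e hμ hadd₁ hadd₂ hgal halt hnondeg inv hK hD ι hM c hc hkol hkM 𝒯
      h𝒯 hperf v hvc hx hy)
    (invWeilPairing_injective_of_symm W M e hμ hadd₁ hadd₂ hgal halt hnondeg inv v hinv) X hX hcard he₀ hcyc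

/-! ### §4 The first global input in situ: the image of the `v`-relaxed hybrid group is isotropic -/

include hK hD hM hc hkol hkM h𝒯 halt hnondeg hperf in
/-- **Poitou–Tate reciprocity at ONE place for the hybrid conditions.** For global classes `x, y ∈ H¹(K, E[2^M])`
satisfying, at every place other than `v`, the HYBRID condition — `𝒯_w` at the (other) places `w` of `c`, E's Kummer
condition at every finite place off `c` and at every infinite place — one has `inv_v(loc_v x ∪ₑ loc_v y) = 0`: every
other term of the Poitou–Tate sum vanishes (Kummer isotropy, resp. `transverse_isotropic_two`), hence so does the one at
`v` (`sum_inv_weilCupProduct_localization_eq_zero`). So the image at `v` of the `v`-relaxed hybrid Selmer group is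
ISOTROPIC — hypothesis `hX` of §3. [cite: MilneADT2006, Ch. I, Thm. 4.10 (b)] [cite: PoonenRains2012, Prop. 4.10] -/
theorem invWeilPairing_localization_eq_zero_of_hybrid_off [NeZero (2 ^ M)]
    [Finite (geomTorsion (W.baseChange K) ((2 ^ M : ℕ) : ℤ))] (hPT : inv.SumLocalTermEqZero)
    (v : HeightOneSpectrum (𝓞 K))
    {x y : galoisCohomology ((W.baseChange K).torsionGaloisModule ((2 ^ M : ℕ) : ℤ)) 1}
    (hxT : ∀ w ∈ placesDividing K c, w ≠ v →
      galoisCohomology.localization ((W.baseChange K).torsionGaloisModule ((2 ^ M : ℕ) : ℤ)) (Sum.inr w) 1 x ∈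
        𝒯 (Sum.inr w))
    (hxK : ∀ w : HeightOneSpectrum (𝓞 K), w ∉ placesDividing K c →
      galoisCohomology.localization ((W.baseChange K).torsionGaloisModule ((2 ^ M : ℕ) : ℤ)) (Sum.inr w) 1 x ∈
        (W.baseChange K).kummerSelmerStructure ((2 ^ M : ℕ) : ℤ) (Sum.inr w))
    (hx0 : ∀ w : InfinitePlace K,
      galoisCohomology.localization ((W.baseChange K).torsionGaloisModule ((2 ^ M : ℕ) : ℤ)) (Sum.inl w) 1 x ∈
        (W.baseChange K).kummerSelmerStructure ((2 ^ M : ℕ) : ℤ) (Sum.inl w))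
    (hyT : ∀ w ∈ placesDividing K c, w ≠ v →
      galoisCohomology.localization ((W.baseChange K).torsionGaloisModule ((2 ^ M : ℕ) : ℤ)) (Sum.inr w) 1 y ∈
        𝒯 (Sum.inr w))
    (hyK : ∀ w : HeightOneSpectrum (𝓞 K), w ∉ placesDividing K c →
      galoisCohomology.localization ((W.baseChange K).torsionGaloisModule ((2 ^ M : ℕ) : ℤ)) (Sum.inr w) 1 y ∈
        (W.baseChange K).kummerSelmerStructure ((2 ^ M : ℕ) : ℤ) (Sum.inr w))
    (hy0 : ∀ w : InfinitePlace K,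
      galoisCohomology.localization ((W.baseChange K).torsionGaloisModule ((2 ^ M : ℕ) : ℤ)) (Sum.inl w) 1 y ∈
        (W.baseChange K).kummerSelmerStructure ((2 ^ M : ℕ) : ℤ) (Sum.inl w)) :
    invWeilPairing (W.baseChange K) (2 ^ M) e hμ hadd₁ hadd₂ hgal inv (Sum.inr v)
      (galoisCohomology.localization ((W.baseChange K).torsionGaloisModule ((2 ^ M : ℕ) : ℤ)) (Sum.inr v) 1 x)
      (galoisCohomology.localization ((W.baseChange K).torsionGaloisModule ((2 ^ M : ℕ) : ℤ)) (Sum.inr v) 1 y) =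
      0 := by
  have hS : ∀ w ∉ ({(Sum.inr v : Place K)} : Finset (Place K)),
      inv w ((weilContPairingLocal (W.baseChange K) (2 ^ M) e hμ hadd₁ hadd₂ hgal w).cupProduct
        (galoisCohomology.localization ((W.baseChange K).torsionGaloisModule ((2 ^ M : ℕ) : ℤ)) w 1 x)
        (galoisCohomology.localization ((W.baseChange K).torsionGaloisModule ((2 ^ M : ℕ) : ℤ)) w 1 y)) = 0 := by
    intro w hw
    rw [Finset.mem_singleton] at hw
    rw [← invWeilPairing_apply]
    rcases w with w | w
    · exact invWeilPairing_eq_zero_of_mem (W.baseChange K) (2 ^ M) e hμ hadd₁ hadd₂ hgal halt inv (Sum.inl w)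
        (hx0 w) (hy0 w)
    · have hwv : w ≠ v := fun h ↦ hw (by rw [h])
      by_cases hwc : w ∈ placesDividing K c
      · exact transverse_isotropic_two W M e hμ hadd₁ hadd₂ hgal halt hnondeg inv hK hD ι hM c hc hkol hkM 𝒯 h𝒯
          hperf w hwc (hxT w hwc hwv) (hyT w hwc hwv)
      · exact invWeilPairing_eq_zero_of_mem (W.baseChange K) (2 ^ M) e hμ hadd₁ hadd₂ hgal halt inv (Sum.inr w)
          (hxK w hwc) (hyK w hwc)
  have h := sum_inv_weilCupProduct_localization_eq_zero (W.baseChange K) (2 ^ M) e hμ hadd₁ hadd₂ hgal inv hPT x y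
    {(Sum.inr v : Place K)} hS
  rwa [Finset.sum_singleton, ← invWeilPairing_apply] at h

end Conductor

end Summit.BirchSwinnertonDyer.BirchSwinnertonDyer.Theorems.KolyvaginAtTwo.RegularRefill

end
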